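import Summits.QuantumFields.YangMills.Theorems.BalabanUVNodesK0RecordFormatNamesCentred

/-!
# K0⁷ — THE RECORD-SIDE FORMAT NAMES, EDITION 19 = THE CENTRED PAIR AND THE CENTRED DATA LITERALS (◆ CRIT-1 g36's D9 brick, price sheet
# `Cruxes/Record13SepCoPHInhabited/CRIT-1-DROWS-v2prime-g36.md` §1 D9 ∕ §2, nodeO STATUS 2026-08-31T07:46:45Z «ONE brick wanted: centred `Response9Data` literal ∕ `recordCurrentC`»):
# `recordBgUnitsC ∕ recordCurrentC ∕ recordEmbJC ∕ recordGkJC` and `recordResponse9Data[From]LC ∕ Response9DAtLC`, `recordResponse9Data[From]JC ∕ Response9DAtJC`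

Cell `ym-nodeO-ideate` ∕ `ym-balaban-port`, DEFINER seat `ym-nodeO-def-1` (gen 36); `--kind definition --supports stmt-QuantumFields-20541 --as helper`; count-neutral.
[I] = [Balaban1987RG1], [15] = [Balaban1985Variational].

WHY.  EXIT (α) (director-ym №515 (4) ∕ №517 (4) ∕ №520 (1); DEF-1 g35 «TUBE TERM»; ◆ CRIT-1 g35 R-CRIT1-g35-2): the wrapping rooted normal form of the record's background carries a
non-decaying pure-gauge tube, so single-volume decay rows displayed on ROOTED representatives (`recordD ∕ recordHr ∕ recordGkL ∕ recordGkJ`'s 𝐔-block, `…FromCtr ∕ FromJ ∕ FromL`) are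
J5′ HITS, while the same rows on CENTRED representatives (`RootedGaugeCentred.rootGaugeC`, ed.18's `recordBgFieldC ∕ recordDC ∕ recordHrC ∕ recordGkLC`) are EXEMPT by construction
(control run 0.2420 → 0.0083).  ◆ CRIT-1 g36's price sheet for v2′ (the JOIN-T kernel step) admits centred rows (D9) «after ONE DEF-1 brick»: (a) no centred `Response9Data` LITERAL or
receipt exists (ed.18 is four defs), and (b) ed.18's `recordGkLC` reads its 𝐉-block from the ROOTED linearised current `recordGkJ` — fine at first order only; a representative that is
centred in BOTH blocks must read the 𝐉-block from `current ∘ recordBgFieldC` (sheet §2: the current is gauge-covariant, `current π ξ (gaugeU u U) = adJ u (current π ξ U)`, so every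
summand of the record functional is unchanged when the rooted pair `(recordBgField B, recordCurrent B)` is replaced by the centred pair).  THIS FILE is that brick.

WHAT THIS FILE IS (definitions only; statement-form; NEW names; §1–§26b and every earlier object untouched — append-only rule):
* §26c THE CENTRED PAIR — byte-twins of §10's `recordBgUnits ∕ recordCurrent ∕ recordEmbJ ∕ recordGkJ` (Names :655 ∕ :660 ∕ :665 ∕ :672) with `recordBgFieldC` in place of `recordBgField`:
  `recordBgUnitsC`, ★ `recordCurrentC` (THE CURRENT OF THE CENTRED BACKGROUND), ★ `recordEmbJC` (two-block coordinates of the centred pair), ★ `recordGkJC` (its first-order response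
  at `B = 0` on the basis fields — 𝐔-block AND 𝐉-block centred).
* §26d THE CENTRED DATA LITERALS AND RECEIPTS, in typer-1's `B12FormatPlus.Response9Data ∕ Response9D` format, byte-parallel to ed.14's `…L` triple (NamesL §22c) and ed.17's
  `…LocUnivξ` triple (NamesLocE §24j) — only the `Gk` slot differs: `recordResponse9DataLC ∕ recordResponse9DataFromLC` (`Gk := recordGkLC`: 𝐔-block centred-then-Landau, 𝐉-block
  rooted — the sheet's D9 literal verbatim) with `rfl` face `…FromLC_eq_update` and receipt `Response9DAtLC`; `recordResponse9DataJC ∕ recordResponse9DataFromJC` (`Gk := recordGkJC`: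
  the centred pair's own response, no Landau step) with `rfl` face `…FromJC_eq_update` and receipt `Response9DAtJC`.

NOT HERE (on ask only): second-order centred letters `recordD2C ∕ (R4ᴰ)″` (sheet §3 (i); ◆ recommends (ii), whose uniform zeroth-order rows are stated on `recordBgFieldC B` directly);
the one-block `…FromCtrC` twin (porters read the J ∕ L charts).

HONEST FRAMING.  Definitions only; NOTHING of Bałaban is asserted, ported or discharged; no token ∕ row is cut on these names here (J1′ ∕ J5′: the cutter's, on the typer's bytes); the
decay of the centred objects is [15] Prop. 9 (190) content (wall W-(190), XL, unported) plus the localised (0.4)-comb gauge term — NOT asserted; the rooted objects, `UkSel`,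
`T4RootedResidualGauge` and all importers are UNCHANGED (BODY-FREEZE); v2′ UNTYPED; 27931 CLOSED·IMPLICATION-ONLY·IN TOTO; 27930 ∕ 26648 OPEN; K0ᴬ ∕ K1ᴬ ∕ K3ᴬ OPEN; NODE O not
inhabited (0∕1); COUNT 8∕28 · K 1∕4 UNMOVED; finite `𝕋⁴_{L^K}` at fixed ε — NOT continuum ∕ ℝ⁴ ∕ OS; **the Yang–Mills mass gap (Clay) is NOT proved by any of this.**  No `sorry`,
`instance`, `notation`; standard axioms.
-/

noncomputable section

open scoped BigOperators Matrix.Norms.L2Operator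

namespace Summit.QuantumFields.YangMills.Theorems.K0RecordFormatNames

open Literature.MathematicalPhysics.QuantumFieldTheory.Balaban1983to89
open Literature.MathematicalPhysics.QuantumFieldTheory.Balaban1983to89.Node00
open Literature.MathematicalPhysics.QuantumFieldTheory.Balaban1983to89.T4Continuum (T4Family)

variable (F : T4Family)

section Theta

variable (θ : Stage13Params F 2)

/-! ## §26c  The CENTRED PAIR `(recordBgFieldC B, J_{k+1}(recordBgFieldC B))`, its two-block coordinates and its first-order response -/

/-- The CENTRED background field of the charted configuration as a `M₂(ℂ)ˣ`-valued fine-bond function (through `ιSU`) — the argument of the current (1.8); byte-twin of `recordBgUnits`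
over `recordBgFieldC`. [cite: Balaban1987RG1, (1.8)–(1.9) p.261, (2.3) p.265] -/
def recordBgUnitsC (k K : ℕ) (B : Fin (F.P K).d → Site (F.P K) (k + 1) → θ.Vβ) : PBond (F.P K) 0 → (MatA 2)ˣ :=
  fun b => ιSU 2 (recordBgFieldC F θ k K B b)

/-- ★ **THE CURRENT OF THE CENTRED BACKGROUND** `J_{k+1}(recordBgFieldC B) = D^{ξ*} ξ⁻² π Im ∂(·)` at `ξ = L^{−(k+1)}` — the tree's (1.8) `B12Eq18Current.current` at the background READ IN THE
CENTRED NORMAL FORM (`= current ∘ recordBgFieldC`; by gauge covariance of the current, `current_gaugeU_eq_adJ`, it is `adJ (combTransporter …)` of the rooted `recordCurrent` — not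
asserted here). Byte-twin of `recordCurrent`. [cite: Balaban1987RG1, (1.8) p.261, (2.3) p.265; Balaban1985Variational, (19) p.281] -/
def recordCurrentC (k K : ℕ) (B : Fin (F.P K).d → Site (F.P K) (k + 1) → θ.Vβ) : PBond (F.P K) 0 → MatA 2 :=
  B12Eq18Current.current sl2Proj ((F.P K).eta (k + 1)) (recordBgUnitsC F θ k K B)

/-- ★ **`ι^C` (two-block) — `recordEmbJC F θ k K`**: `B ↦ (sl2Coord (log recordBgFieldC B (b)), sl2Coord (J_{k+1}(recordBgFieldC B)(b)))_b` — the CENTRED pair `(U_j, J_j)` of (1.9) in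
two-block chart coordinates; byte-twin of `recordEmbJ` with BOTH blocks read from the centred normal form. [cite: Balaban1987RG1, (1.8)–(1.9) p.261, (4.35) p.290, (2.3) p.265] -/
def recordEmbJC (k K : ℕ) (B : Fin (F.P K).d → Site (F.P K) (k + 1) → θ.Vβ) : Fin (recordChartDimJ F K) → ℂ :=
  fun i => Sum.elim
    (fun a => sl2Coord (MatrixLog.mlog ((recordBgFieldC F θ k K B ((chartEquivJ F K).symm i).1 : SU 2) : MatA 2)) a)
    (fun a => sl2Coord (recordCurrentC F θ k K B ((chartEquivJ F K).symm i).1) a)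
    ((chartEquivJ F K).symm i).2

/-- ★ **`G_k^{JC}` — `recordGkJC F θ k K a l i`**: the FIRST-ORDER RESPONSE OF THE CENTRED PAIR at `B = 0` on the basis field `δ_l ⊗ bV a` (`Dι^C(0)`; both the `log U`- and the
`J`-responses centred — the 𝐉-block is the linearised CENTRED current, not the rooted `recordGkJ`); byte-twin of `recordGkJ`. [cite: Balaban1987RG1, (4.35) p.290, (1.9) p.261; Balaban1985Variational, Prop. 9 p.309] -/
def recordGkJC (k K : ℕ) (a : θ.ιβ) (l : RespLabel F k K) (i : Fin (recordChartDimJ F K)) : ℂ :=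
  letI := θ.instVβ₁; letI := θ.instVβ₂; letI := θ.instιβ
  fderiv ℝ (recordEmbJC F θ k K) 0 (Pi.single l.1 (Pi.single l.2 (θ.bV a))) i

/-! ## §26d  The CENTRED data literals and their receipts (typer-1's `Response9Data ∕ Response9D` format; only the `Gk` slot differs from ed.14 ∕ ed.17) -/

/-- **The centred-Landau response data** (unshifted): typer-1's `Response9Data` at the record with `Gk := fun K => recordGkLC F θ k K a` (𝐔-block = 𝔰𝔩₂-coordinates of `recordHrC … a l`,
the (21)-Landau representative of the CENTRED rooted response, ed.18; 𝐉-block = the rooted `recordGkJ` — first order), every other field as in `recordResponse9DataL ∕ …J`.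
[cite: Balaban1985Variational, Prop. 9 p.309, (190) p.308, (21) p.281; Balaban1987RG1, (4.35) p.290] -/
def recordResponse9DataLC (a : θ.ιβ) (Mc k : ℕ) :
    B12FormatPlus.Response9Data (recordDomSys F Mc k) (recordBondCount F) (recordChartDimJ F) 4 where
  Cc := recordCc F Mc k
  Λ := RespLabel F k
  G := recordSiteGeom F Mc k
  ρ := recordRho F k
  e := recordE F k
  cX := recordCXJ F Mc k
  siteOf := fun K => recordSiteOfJ F k K
  Gk := fun K => recordGkLC F θ k K a
  wrap := recordWrapCtr F Mc k
  emb := recordDomEmbCtr F Mc k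
  jX := fun K _ => recordJXJ F K
  πc := fun K _ => recordCoordProjCtr F K

/-- ★ **The centred-Landau response data from the base volume `K₀`** (member `n` = volume `K₀ + n`): `Gk := fun n => recordGkLC F θ k (K₀ + n) a`, every other field = the CENTRED
two-volume layer fields of `recordResponse9DataFromJ ∕ …FromL ∕ …FromLocUnivξ` verbatim — ◆'s D9 literal `{ recordResponse9DataFromL … with Gk := fun n => recordGkLC F θ k (K₀+n) a }` as a
NAME (face below).  J5′ EXEMPT column. [cite: Balaban1985Variational, Prop. 9 p.309, (190) p.308, (21) p.281; Balaban1987RG1, (1.21) p.264, (4.35) p.290] -/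
def recordResponse9DataFromLC (a : θ.ιβ) (Mc k K₀ : ℕ) :
    B12FormatPlus.Response9Data (fun n => recordDomSys F Mc k (K₀ + n)) (fun n => recordBondCount F (K₀ + n)) (fun n => recordChartDimJ F (K₀ + n)) 4 where
  Cc := fun n => recordCc F Mc k (K₀ + n)
  Λ := fun n => RespLabel F k (K₀ + n)
  G := fun n => recordSiteGeom F Mc k (K₀ + n)
  ρ := fun n => recordRho F k (K₀ + n)
  e := fun n => recordE F k (K₀ + n)
  cX := fun n => recordCXJ F Mc k (K₀ + n)
  siteOf := fun n => recordSiteOfJ F k (K₀ + n)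
  Gk := fun n => recordGkLC F θ k (K₀ + n) a
  wrap := fun n => recordWrapCtr F Mc k (K₀ + n)
  emb := fun n => recordDomEmbCtr F Mc k (K₀ + n)
  jX := fun n _ => recordJXJ F (K₀ + n)
  πc := fun n _ => recordCoordProjCtr F (K₀ + n)

/-- FACE (by `rfl`): the centred-Landau data IS ed.14's `recordResponse9DataFromL` with the `Gk` slot UPDATED — either spelling serves a consumer.
[cite: Balaban1985Variational, Prop. 9 p.309; Balaban1987RG1, (4.35) p.290] -/
theorem recordResponse9DataFromLC_eq_update (a : θ.ιβ) (Mc k K₀ : ℕ) :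
    recordResponse9DataFromLC F θ a Mc k K₀ =
      { recordResponse9DataFromL F θ a Mc k K₀ with Gk := fun n => recordGkLC F θ k (K₀ + n) a } := rfl

/-- **RECEIPT `Response9DAtLC F θ a Mc k K₀ α₂ C₉ δ₀`**: typer-1's plain `B12FormatPlus.Response9D` ((R0) constants, (R1ᴰ) one-volume decay, (R3) unwrap compatibility, (R4ᴰ)
two-volume comparison, (R5) chart intertwining) for the centred-Landau data from the base volume `K₀`, in the gauge norm of the two-block (4.4) domain, CENTRED layer, radius
`recordRNat` — the shape of ed.14's `Response9DAtL` ∕ ed.17's `Response9DAtLocUnivξ`.  Prop-valued; DISPLAYED, asserts nothing (its rows are cutter ∕ porter material on the centred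
representative; content W-(190) + the localised comb term, unported). [cite: Balaban1985Variational, Prop. 9 p.309, (190) p.308; Balaban1987RG1, (4.4) p.281, (1.21) p.264, (4.35) p.290] -/
def Response9DAtLC (a : θ.ιβ) (Mc k K₀ : ℕ) (α₂ C₉ δ₀ : ℝ) : Prop :=
  B12FormatPlus.Response9D (recordResponse9DataFromLC F θ a Mc k K₀) (fun n => recordChartJ F Mc k (K₀ + n)) (fun n => recordRNat F Mc k (K₀ + n))
    (fun n X => recordDom44J F Mc k (K₀ + n) X α₂) C₉ δ₀

/-- **The centred-PAIR response data** (unshifted): typer-1's `Response9Data` at the record with `Gk := fun K => recordGkJC F θ k K a` (the centred pair's own first-order response, BOTH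
blocks centred, no Landau step), every other field as in `recordResponse9DataJ`. [cite: Balaban1985Variational, Prop. 9 p.309; Balaban1987RG1, (1.9) p.261, (4.35) p.290] -/
def recordResponse9DataJC (a : θ.ιβ) (Mc k : ℕ) :
    B12FormatPlus.Response9Data (recordDomSys F Mc k) (recordBondCount F) (recordChartDimJ F) 4 where
  Cc := recordCc F Mc k
  Λ := RespLabel F k
  G := recordSiteGeom F Mc k
  ρ := recordRho F k
  e := recordE F k
  cX := recordCXJ F Mc k
  siteOf := fun K => recordSiteOfJ F k K
  Gk := fun K => recordGkJC F θ k K a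
  wrap := recordWrapCtr F Mc k
  emb := recordDomEmbCtr F Mc k
  jX := fun K _ => recordJXJ F K
  πc := fun K _ => recordCoordProjCtr F K

/-- ★ **The centred-PAIR response data from the base volume `K₀`** (member `n` = volume `K₀ + n`): `Gk := fun n => recordGkJC F θ k (K₀ + n) a`, every other field = `recordResponse9DataFromJ`'s
verbatim.  J5′ EXEMPT column (centred in both blocks). [cite: Balaban1985Variational, Prop. 9 p.309; Balaban1987RG1, (1.9) p.261, (1.21) p.264, (4.35) p.290] -/
def recordResponse9DataFromJC (a : θ.ιβ) (Mc k K₀ : ℕ) :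
    B12FormatPlus.Response9Data (fun n => recordDomSys F Mc k (K₀ + n)) (fun n => recordBondCount F (K₀ + n)) (fun n => recordChartDimJ F (K₀ + n)) 4 where
  Cc := fun n => recordCc F Mc k (K₀ + n)
  Λ := fun n => RespLabel F k (K₀ + n)
  G := fun n => recordSiteGeom F Mc k (K₀ + n)
  ρ := fun n => recordRho F k (K₀ + n)
  e := fun n => recordE F k (K₀ + n)
  cX := fun n => recordCXJ F Mc k (K₀ + n)
  siteOf := fun n => recordSiteOfJ F k (K₀ + n)
  Gk := fun n => recordGkJC F θ k (K₀ + n) a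
  wrap := fun n => recordWrapCtr F Mc k (K₀ + n)
  emb := fun n => recordDomEmbCtr F Mc k (K₀ + n)
  jX := fun n _ => recordJXJ F (K₀ + n)
  πc := fun n _ => recordCoordProjCtr F (K₀ + n)

/-- FACE (by `rfl`): the centred-pair data IS §10's `recordResponse9DataFromJ` with the `Gk` slot UPDATED. [cite: Balaban1985Variational, Prop. 9 p.309; Balaban1987RG1, (4.35) p.290] -/
theorem recordResponse9DataFromJC_eq_update (a : θ.ιβ) (Mc k K₀ : ℕ) :
    recordResponse9DataFromJC F θ a Mc k K₀ =
      { recordResponse9DataFromJ F θ a Mc k K₀ with Gk := fun n => recordGkJC F θ k (K₀ + n) a } := rfl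

/-- **RECEIPT `Response9DAtJC F θ a Mc k K₀ α₂ C₉ δ₀`**: typer-1's plain `B12FormatPlus.Response9D` for the centred-PAIR data from the base volume `K₀`, gauge norm of the two-block (4.4)
domain, CENTRED layer, radius `recordRNat` — the shape of §10's `Response9DAtJ`.  Prop-valued; DISPLAYED, asserts nothing. [cite: Balaban1985Variational, Prop. 9 p.309, (190) p.308; Balaban1987RG1, (1.9) p.261, (4.4) p.281, (1.21) p.264] -/
def Response9DAtJC (a : θ.ιβ) (Mc k K₀ : ℕ) (α₂ C₉ δ₀ : ℝ) : Prop :=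
  B12FormatPlus.Response9D (recordResponse9DataFromJC F θ a Mc k K₀) (fun n => recordChartJ F Mc k (K₀ + n)) (fun n => recordRNat F Mc k (K₀ + n))
    (fun n X => recordDom44J F Mc k (K₀ + n) X α₂) C₉ δ₀

end Theta

end Summit.QuantumFields.YangMills.Theorems.K0RecordFormatNames

end
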